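import Literature.NumberTheory.Automorphic.CDTTheorem722
import Literature.NumberTheory.Automorphic.CDTTheorem712
import Literature.NumberTheory.Automorphic.BCDTModularity
import Literature.NumberTheory.Automorphic.BCDTModularityModPProofs
import Literature.NumberTheory.Automorphic.HeckeAlgebraOfTypeSigma
import Literature.NumberTheory.Automorphic.ChebotarevArtinRepHolds
import Literature.NumberTheory.EllipticCurves.FramedTateGaloisRep
import Literature.NumberTheory.EllipticCurves.FrobeniusTraceBaseChange
import Literature.NumberTheory.EllipticCurves.FrobeniusTateModuleProofs
import Literature.NumberTheory.EllipticCurves.TateModuleFreeProofs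
import Literature.NumberTheory.EllipticCurves.TateModuleFinrankProofs
import Literature.NumberTheory.EllipticCurves.NewformGaloisRepModLOfPadicAlgClProofs
import Literature.NumberTheory.EllipticCurves.ModularityVersionApProofs
import Literature.NumberTheory.GaloisRepresentations.FramedRepBaseChange
import Literature.NumberTheory.GaloisRepresentations.ResidualGaloisRep
import Literature.NumberTheory.GaloisRepresentations.ResidualRepRestrict
import Literature.NumberTheory.GaloisRepresentations.PatchingLemma
import Literature.NumberTheory.GaloisRepresentations.FrobeniusDensity
import Literature.NumberTheory.GaloisRepresentations.IrreducibleOfIrreducibleReduction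
import Literature.NumberTheory.GaloisRepresentations.OrdinaryGaloisRep
import Literature.NumberTheory.GaloisRepresentations.CalegariEvenFontaineMazurTwo
import Literature.NumberTheory.GaloisRepresentations.AbsolutelyIrreducibleReduction
import Literature.NumberTheory.GaloisRepresentations.ResidualRepOfTraceCongruence
import Literature.RepresentationTheory.Semisimple.IrreducibleOfCharpoly
import Literature.NumberTheory.DiophantineGeometry.Conductor
import Literature.FieldTheory.AlgClosed.PadicAlgClEquivComplex
import HarnessLib

/-!
# Stub-ideation k = 2, GENERATION 11 (home family 2 = RESHAPE) for `stub_liftFive` of crux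
# `FreyModularity` (stmt-ABC-11340, route ABC/DefiniteXi, line `Lines/Sketch.lean` sha 21576c53)

Companion of `STUB-IDEAS-stub_liftFive-2.md` (gen 11).  `stub_liftFive` (Diamond 1996 Thm. 5.3 =
`CDT_theorem_7_2_2 ∩ {25 ∤ N}`) is consumed ONCE, in case B of `isModular_freyCurve_of_stubs`, where
the Frey curve is semistable and MULTIPLICATIVE at `5`.

Gens 7–10 of this seat weakened the one opaque debt three times
(X′ conjugacy ⟸ X″ traces ⟸ X‴ `MLTFrobTraceFive` Frobenius traces, all adapters PROVED) but every
version still spoke about the CURVE `W` (`W.framedTateGaloisRep 5`, `W.conductorNorm`,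
`W.IsTorsionGaloisRep`).  An `R_Σ = T_Σ` theorem knows nothing about curves.  Gen 11 makes two moves:

* **T-A (currency change, "eliminate `W`")** — the debt becomes the PURE GALOIS-LEVEL statement
  X⁵ `DiamondCor62FrobTraceFiveOrd` = Diamond, CSS ch. XVII **Cor. 6.2** / DDT **Cor. 3.46** at `ℓ = 5`,
  read in Frobenius-trace currency over the gen-7 carrier `Φ_S` (`modularLiftsOfTypeSigmaSemistable`):
  for ANY continuous `τ : Γ_ℚ → GL₂(ℚ̄₅)` with cyclotomic determinant, unramified outside `S ∪ {5}`,
  ORDINARY of weight `2` at `5` (`FramedGaloisRep.IsOrdinaryOfWeightAt 5 τ v 2 1`, Skinner–Wiles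
  shape, already in the tree), residually `≡ ρ̄ ⊗ 𝔽̄₅` (`HasResidualCharpolys`, DDT §2.1, in the tree)
  with `ρ̄|ℚ(√5)` absolutely irreducible, and congruent to a member `ρ₀ ∈ Φ_S` — some member `ρ' ∈ Φ_S`
  has the Frobenius traces of `τ` off a finite set.  This is exactly the socket an `R_Σ = T_Σ`
  formalisation (k1's `ModularityLifting_framed`, k1-liftThree Plans 2–7) outputs, and it no longer
  mentions `W`: the curve enters only through three PROVED/one-cycle adapters RC, UR, DET below.
* **T-B (regime split at `5`)** — only the ORDINARY regime is typed (case B ⇒ the Frey curve is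
  multiplicative at `5`: k3-g4 `hasMultiplicativeReductionAtPrime_five_of_caseB`; multiplicative ⇒
  ordinary of weight `2`: k3-g10 `isOrdinaryOfWeightAt_framedTateGaloisRep_of_hasMultiplicativeReductionAt`,
  PROVED, 0 sorries).  The flat / good-supersingular regime of `stub_liftFive` is never consumed by the
  skeleton and stays on the verbatim stub.

Kernel-checked content of this file (NO `sorry`; helper STATEMENTS are `def … : Prop`, every
`theorem` is proved):
* UR `unramifiedOffConductorFive_holds` — `p_v ∤ N_W`, `p_v ≠ 5` ⇒ `ρ_{W,5}` unramified at `v` (PROVED);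
* DET `det_framedTateGaloisRep_eq_cyclotomic` — `det ρ_{W,5} = χ₅` in `ℚ̄₅` (gen 9, PROVED, verbatim);
* B1a `padicIntHomCompat_holds` (the ring map `ℤ₅ → ℤ̄₅`, PROVED), RC `residualCharpolysOfTorsionFive_holds`
  (`ρ̄ ≅ W[5]` gives the residual characteristic polynomials of `ρ_{W,5}`, PROVED) and hence
  B1 `irredFramedTateFive_holds` (gen 10's B1, PROVED here, in the tree: `FramedGaloisRep.isIrreducible_of_hasResidualCharpolys`);
* the adapter X⁵ + RC ⇒ X‴ₒ `mltFrobTraceFiveOrd_of_galois` (PROVED, pure logic + UR + DET);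
* ORD + X‴ₒ ⇒ X‴ₘ `mltFrobTraceFiveMult_of_ord` (PROVED) and the gen-10 chain threaded through the
  multiplicative regime X‴ₘ ⇒ X″ₘ ⇒ X′ₘ (`debtMult_of_frobTraceMult`, PROVED, proofs = gen 10's);
* sanity: X‴ ⇒ X‴ₒ ⇒ X‴ₘ are WEAKENINGS of gen 10's X‴ (`frobTraceFiveOrd_of_frobTrace`, …).
So after gen 11 the k2 line reads (`debtMult_of_X5_ORD`): case B ⟸ SwitchPlus + {M2,M3,M4,O1a,O1d}
(gen 9, one-cycle) + G1 (k3-g4) + ORD (k3-g10, PROVED) + **X⁵ (the W-free `R = T` output at `5`)**.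
-/

noncomputable section

open scoped MatrixGroups Matrix NumberField ModularForm Polynomial Classical NNReal
open NumberField IsDedekindDomain IsDedekindDomain.HeightOneSpectrum Polynomial Filter
open Literature.NumberTheory Literature.NumberTheory.Automorphic Literature.NumberTheory.Automorphic.BCDT
open Literature.NumberTheory.GaloisRepresentations Literature.NumberTheory.GaloisRepresentations.ModPGaloisRep
open Literature.NumberTheory.EllipticCurves Literature.NumberTheory.EllipticCurves.ModularForms
open CongruenceSubgroup Rat.HeightOneSpectrum WeierstrassCurve Field IsLocalRing

namespace Summit.ABC.ABC.Cruxes.FreyModularity.StubIdeas.LiftFive2g11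

universe u v

/-! ### Carrier and gen-10's debt X‴ (copied VERBATIM from `StubIdeas.LiftFive2g10`) -/

section Carrier

variable (p : ℕ) (k : ℤ) {O : Type u} [CommRing O] [TopologicalSpace O]
  (Ō : Type v) [CommRing Ō] [IsLocalRing Ō] [TopologicalSpace Ō] [Algebra O Ō]
  (ρ : FramedGaloisRep ℚ O 2) (S : Set ℕ)

/-- `N_Σ^{ss}(Ō)` = Diamond's `Φ_Σ` — verbatim `modularLiftsOfTypeSigma` (DFG §3.1) with the level
condition `¬ p ∣ M` relaxed to `¬ p ^ 2 ∣ M` (DDT Def. 3.25 / Lemma 3.26; Diamond CSS XVII §5: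
"`N_g` not divisible by `ℓ²`").  Identical to gens 7–10.
[cite: DarmonDiamondTaylor1995, §3.3 (p. 94)] [cite: Diamond1997CSS, §5 (p. 571)] -/
def modularLiftsOfTypeSigmaSemistable : Set (FramedGaloisRep ℚ Ō 2) :=
  {ρ' | (∃ (M : ℕ) (_ : NeZero M) (g : CuspForm (Gamma1 M) k) (j : coeffCharIntegers g →+* Ō),
          IsNewform1 g ∧ ¬ p ^ 2 ∣ M ∧ IsGaloisRepOfNewform1Int g j {r | r ∣ M * p} ρ') ∧
      (∀ (σ : absoluteGaloisGroup ℚ) (i : ℕ),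
          (FramedRep.charpoly ρ' σ).coeff i - algebraMap O Ō ((FramedRep.charpoly ρ σ).coeff i) ∈
            maximalIdeal Ō) ∧
      (∀ σ : absoluteGaloisGroup ℚ,
          ((ρ' σ : GL (Fin 2) Ō) : Matrix (Fin 2) (Fin 2) Ō).det =
            algebraMap O Ō ((ρ σ : GL (Fin 2) O) : Matrix (Fin 2) (Fin 2) O).det) ∧
      ∀ v : HeightOneSpectrum (𝓞 ℚ), ((primesEquiv v : Nat.Primes) : ℕ) ∉ S →
        ((primesEquiv v : Nat.Primes) : ℕ) ≠ p → ρ'.IsMinimallyRamifiedAt v}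

end Carrier

/-- **X′ `MLTTateSemistableFive'`** (gen 8's debt, verbatim): `ρ_{W,5}` is conjugate to a member of
`N_S^{ss}(ρ₀)`. [cite: Stevens1997Overview, (7.4) Theorem and Corollary, p. 74] [cite: Diamond1996, Thm. 5.3] -/
def MLTTateSemistableFive' : Prop :=
  ∀ (W : WeierstrassCurve ℚ) [W.IsElliptic] (ρ : ModPGaloisRep ℚ (ZMod 5) 2),
    W.IsTorsionGaloisRep 5 ρ → ρ.IsAbsIrreducibleOverSqrt 5 → ¬ 25 ∣ W.conductorNorm ℤ →
    ∀ (hf : Continuous (padicAlgClIntegers 5).subtype)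
      (ρ₀ : FramedGaloisRep ℚ (padicAlgClIntegers 5) 2) (S : Set ℕ),
      ρ₀ ∈ modularLiftsOfTypeSigmaSemistable 5 2 (padicAlgClIntegers 5) ρ₀ S →
      (∀ (σ : absoluteGaloisGroup ℚ) (i : ℕ),
        Valued.v (((FramedRep.charpoly ρ₀ σ).coeff i : PadicAlgCl 5) -
          (FramedRep.charpoly (W.framedTateGaloisRep 5) σ).coeff i) < 1) →
      (∀ σ : absoluteGaloisGroup ℚ,
        (((ρ₀ σ : GL (Fin 2) (padicAlgClIntegers 5)) :
            Matrix (Fin 2) (Fin 2) (padicAlgClIntegers 5)).det : PadicAlgCl 5) =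
          ((W.framedTateGaloisRep 5 σ : GL (Fin 2) (PadicAlgCl 5)) :
            Matrix (Fin 2) (Fin 2) (PadicAlgCl 5)).det) →
      S.Finite → 5 ∉ S → (∀ q : ℕ, q.Prime → q ∣ W.conductorNorm ℤ → q ≠ 5 → q ∈ S) →
      ∃ ρ' ∈ modularLiftsOfTypeSigmaSemistable 5 2 (padicAlgClIntegers 5) ρ₀ S,
        ∃ P : GL (Fin 2) (PadicAlgCl 5),
          FramedRep.conj P (FramedRep.baseChange (padicAlgClIntegers 5).subtype hf ρ') =
            W.framedTateGaloisRep 5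

/-- **X‴ `MLTFrobTraceFive`** (gen 10's debt, verbatim): some member `ρ'` of `N_S^{ss}(ρ₀)` has the
Frobenius traces of `ρ_{W,5}` off a finite set of places.
[cite: DarmonDiamondTaylor1995, Thm. 3.42 and Cor. 3.46] [cite: Diamond1996, Thm. 5.3] -/
def MLTFrobTraceFive : Prop :=
  ∀ (W : WeierstrassCurve ℚ) [W.IsElliptic] (ρ : ModPGaloisRep ℚ (ZMod 5) 2),
    W.IsTorsionGaloisRep 5 ρ → ρ.IsAbsIrreducibleOverSqrt 5 → ¬ 25 ∣ W.conductorNorm ℤ →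
    ∀ (ρ₀ : FramedGaloisRep ℚ (padicAlgClIntegers 5) 2) (S : Set ℕ),
      ρ₀ ∈ modularLiftsOfTypeSigmaSemistable 5 2 (padicAlgClIntegers 5) ρ₀ S →
      (∀ (σ : absoluteGaloisGroup ℚ) (i : ℕ),
        Valued.v (((FramedRep.charpoly ρ₀ σ).coeff i : PadicAlgCl 5) -
          (FramedRep.charpoly (W.framedTateGaloisRep 5) σ).coeff i) < 1) →
      (∀ σ : absoluteGaloisGroup ℚ,
        (((ρ₀ σ : GL (Fin 2) (padicAlgClIntegers 5)) :
            Matrix (Fin 2) (Fin 2) (padicAlgClIntegers 5)).det : PadicAlgCl 5) =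
          ((W.framedTateGaloisRep 5 σ : GL (Fin 2) (PadicAlgCl 5)) :
            Matrix (Fin 2) (Fin 2) (PadicAlgCl 5)).det) →
      S.Finite → 5 ∉ S → (∀ q : ℕ, q.Prime → q ∣ W.conductorNorm ℤ → q ≠ 5 → q ∈ S) →
      ∃ ρ' ∈ modularLiftsOfTypeSigmaSemistable 5 2 (padicAlgClIntegers 5) ρ₀ S,
        ∃ S' : Set (HeightOneSpectrum (𝓞 ℚ)), S'.Finite ∧
          ∀ v ∉ S', ∀ 𝔓 ∈ v.primesAbove, ∀ σ : absoluteGaloisGroup ℚ, IsArithFrobAt (𝓞 ℚ) σ 𝔓 →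
            ((FramedRep.trace ρ' σ : padicAlgClIntegers 5) : PadicAlgCl 5) =
              FramedRep.trace (W.framedTateGaloisRep 5) σ

/-! ### T-A (gen 11) — the W-FREE debt X⁵: Diamond CSS XVII Cor. 6.2 / DDT Cor. 3.46 at `ℓ = 5`,
ordinary regime, Frobenius-trace currency -/

/-- `ρ̄ ⊗ 𝔽̄₅`: the mod-`5` representation pushed into the residue field `ℤ̄₅/𝔪` of `ℚ̄₅` along the
canonical `𝔽₅ → ℤ̄₅/𝔪` (`zmodToPadicAlgClResidueField`, in the tree). [folklore] -/
def residualModFive (ρ : ModPGaloisRep ℚ (ZMod 5) 2) :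
    absoluteGaloisGroup ℚ →* GL (Fin 2) (padicAlgClResidueField 5) :=
  (Matrix.GeneralLinearGroup.map (zmodToPadicAlgClResidueField 5)).comp
    (ρ : absoluteGaloisGroup ℚ →* GL (Fin 2) (ZMod 5))

/-- **X⁵ `DiamondCor62FrobTraceFiveOrd` (THE NEW DEBT — no curve in sight).**  Let
`τ : Γ_ℚ → GL₂(ℚ̄₅)` be continuous with
(a) residual characteristic polynomials those of `ρ̄ ⊗ 𝔽̄₅` (`HasResidualCharpolys`, DDT §2.1) for a
    `ρ̄ : Γ_ℚ → GL₂(𝔽₅)` absolutely irreducible on `Γ_{ℚ(√5)}` (Diamond: "`ρ̄|G_L` irreducible",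
    `L = ℚ(√(εℓ))`, `ε = 1` at `ℓ = 5`);
(b) `det τ = χ₅` (DDT Cor. 3.46 (d));
(c) `τ` unramified at every place `v` with `p_v ∉ S ∪ {5}`, `S` finite, `5 ∉ S` ("unramified outside
    a finite set of primes");
(d) `τ` ORDINARY OF WEIGHT `2` at the place over `5` (Skinner–Wiles shape `(χ₅ ψ₁ ∗; 0 ψ₂)`,
    `ψᵢ|I₅ = 1`: the ordinary half of "semistable at `ℓ` in the sense of [DDT] §2.4");
(e) `τ ≡ ρ₀ (mod 𝔪)` coefficientwise on characteristic polynomials and `det τ = det ρ₀` for a member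
    `ρ₀ ∈ Φ_S(ρ₀)` (so `ρ̄` IS MODULAR of type `S`: Diamond's standing hypothesis "`ρ̄ ≅ ρ̄_f`").
Then some `ρ' = ρ_{g,j} ∈ Φ_S(ρ₀)` has `tr ρ'(Frob_v) = tr τ(Frob_v)` at all places off a finite set
(Cor. 6.2: "`ρ` is modular"; its proof, = DDT p. 102: `R_Σ ≅ T_Σ → 𝒪`, `T_p ↦ tr ρ(Frob_p) = a_p(g)`
for a newform `g ∈ Φ_Σ`).  SIZE XL (named-fact level: it IS the `R = T` theorem's output).
[cite: Diamond1997CSS, Cor. 6.2 (p. 571) with Thm. 6.1 and §5] [cite: DarmonDiamondTaylor1995, Cor. 3.46 (p. 102), Thm. 3.42]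
[cite: Diamond1996, Thm. 5.3] [cite: SkinnerWiles1999, §1 Theorem (ii)] -/
def DiamondCor62FrobTraceFiveOrd : Prop :=
  ∀ (ρ : ModPGaloisRep ℚ (ZMod 5) 2) (τ : FramedGaloisRep ℚ (PadicAlgCl 5) 2),
    ρ.IsAbsIrreducibleOverSqrt 5 →
    HasResidualCharpolys (RingHom.id (padicAlgClResidueField 5))
      (τ : absoluteGaloisGroup ℚ →* GL (Fin 2) (PadicAlgCl 5)) (residualModFive ρ) →
    (∀ σ : absoluteGaloisGroup ℚ,
      ((τ σ : GL (Fin 2) (PadicAlgCl 5)) : Matrix (Fin 2) (Fin 2) (PadicAlgCl 5)).det =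
        algebraMap ℚ_[5] (PadicAlgCl 5) (PadicInt.Coe.ringHom (p := 5)
          ((GaloisRep.cyclotomicCharacter ℚ 5 σ : ℤ_[5]ˣ) : ℤ_[5]))) →
    ∀ (ρ₀ : FramedGaloisRep ℚ (padicAlgClIntegers 5) 2) (S : Set ℕ),
      ρ₀ ∈ modularLiftsOfTypeSigmaSemistable 5 2 (padicAlgClIntegers 5) ρ₀ S →
      (∀ (σ : absoluteGaloisGroup ℚ) (i : ℕ),
        Valued.v (((FramedRep.charpoly ρ₀ σ).coeff i : PadicAlgCl 5) -
          (FramedRep.charpoly τ σ).coeff i) < 1) →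
      (∀ σ : absoluteGaloisGroup ℚ,
        (((ρ₀ σ : GL (Fin 2) (padicAlgClIntegers 5)) :
            Matrix (Fin 2) (Fin 2) (padicAlgClIntegers 5)).det : PadicAlgCl 5) =
          ((τ σ : GL (Fin 2) (PadicAlgCl 5)) : Matrix (Fin 2) (Fin 2) (PadicAlgCl 5)).det) →
      S.Finite → 5 ∉ S →
      (∀ v : HeightOneSpectrum (𝓞 ℚ), ((primesEquiv v : Nat.Primes) : ℕ) ∉ S →
        ((primesEquiv v : Nat.Primes) : ℕ) ≠ 5 → τ.IsUnramifiedAt v) →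
      (∀ v : HeightOneSpectrum (𝓞 ℚ), ((5 : ℕ) : 𝓞 ℚ) ∈ v.asIdeal →
        FramedGaloisRep.IsOrdinaryOfWeightAt 5 τ v 2 1) →
      ∃ ρ' ∈ modularLiftsOfTypeSigmaSemistable 5 2 (padicAlgClIntegers 5) ρ₀ S,
        ∃ S' : Set (HeightOneSpectrum (𝓞 ℚ)), S'.Finite ∧
          ∀ v ∉ S', ∀ 𝔓 ∈ v.primesAbove, ∀ σ : absoluteGaloisGroup ℚ, IsArithFrobAt (𝓞 ℚ) σ 𝔓 →
            ((FramedRep.trace ρ' σ : padicAlgClIntegers 5) : PadicAlgCl 5) = FramedRep.trace τ σ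

/-! ### T-B (gen 11) — the regime-split forms of gen 10's debt (curve side) -/

/-- **X‴ₒ `MLTFrobTraceFiveOrd`**: gen 10's X‴ with ONE extra hypothesis — `ρ_{W,5}` is ordinary of
weight `2` at the place over `5`.  WEAKER than X‴ (`frobTraceFiveOrd_of_frobTrace`).
[cite: Diamond1996, Thm. 5.3 (ordinary case)] [cite: SkinnerWiles1999, §1 Theorem (ii)] -/
def MLTFrobTraceFiveOrd : Prop :=
  ∀ (W : WeierstrassCurve ℚ) [W.IsElliptic] (ρ : ModPGaloisRep ℚ (ZMod 5) 2),
    W.IsTorsionGaloisRep 5 ρ → ρ.IsAbsIrreducibleOverSqrt 5 → ¬ 25 ∣ W.conductorNorm ℤ →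
    (∀ v : HeightOneSpectrum (𝓞 ℚ), ((5 : ℕ) : 𝓞 ℚ) ∈ v.asIdeal →
      FramedGaloisRep.IsOrdinaryOfWeightAt 5 (W.framedTateGaloisRep 5) v 2 1) →
    ∀ (ρ₀ : FramedGaloisRep ℚ (padicAlgClIntegers 5) 2) (S : Set ℕ),
      ρ₀ ∈ modularLiftsOfTypeSigmaSemistable 5 2 (padicAlgClIntegers 5) ρ₀ S →
      (∀ (σ : absoluteGaloisGroup ℚ) (i : ℕ),
        Valued.v (((FramedRep.charpoly ρ₀ σ).coeff i : PadicAlgCl 5) -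
          (FramedRep.charpoly (W.framedTateGaloisRep 5) σ).coeff i) < 1) →
      (∀ σ : absoluteGaloisGroup ℚ,
        (((ρ₀ σ : GL (Fin 2) (padicAlgClIntegers 5)) :
            Matrix (Fin 2) (Fin 2) (padicAlgClIntegers 5)).det : PadicAlgCl 5) =
          ((W.framedTateGaloisRep 5 σ : GL (Fin 2) (PadicAlgCl 5)) :
            Matrix (Fin 2) (Fin 2) (PadicAlgCl 5)).det) →
      S.Finite → 5 ∉ S → (∀ q : ℕ, q.Prime → q ∣ W.conductorNorm ℤ → q ≠ 5 → q ∈ S) →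
      ∃ ρ' ∈ modularLiftsOfTypeSigmaSemistable 5 2 (padicAlgClIntegers 5) ρ₀ S,
        ∃ S' : Set (HeightOneSpectrum (𝓞 ℚ)), S'.Finite ∧
          ∀ v ∉ S', ∀ 𝔓 ∈ v.primesAbove, ∀ σ : absoluteGaloisGroup ℚ, IsArithFrobAt (𝓞 ℚ) σ 𝔓 →
            ((FramedRep.trace ρ' σ : padicAlgClIntegers 5) : PadicAlgCl 5) =
              FramedRep.trace (W.framedTateGaloisRep 5) σ

/-- **X‴ₘ `MLTFrobTraceFiveMult`**: gen 10's X‴ restricted to curves MULTIPLICATIVE at the place over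
`5` — the only regime the consumer (case B) ever meets.  WEAKER than X‴ₒ given ORD
(`mltFrobTraceFiveMult_of_ord`). [cite: Diamond1996, Thm. 5.3] [cite: DarmonDiamondTaylor1995, Prop. 2.23 / Remark 2.24 (p. 64)] -/
def MLTFrobTraceFiveMult : Prop :=
  ∀ (W : WeierstrassCurve ℚ) [W.IsElliptic] (ρ : ModPGaloisRep ℚ (ZMod 5) 2),
    W.IsTorsionGaloisRep 5 ρ → ρ.IsAbsIrreducibleOverSqrt 5 → ¬ 25 ∣ W.conductorNorm ℤ →
    (∀ v : HeightOneSpectrum (𝓞 ℚ), ((5 : ℕ) : 𝓞 ℚ) ∈ v.asIdeal → W.HasMultiplicativeReductionAt v) →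
    ∀ (ρ₀ : FramedGaloisRep ℚ (padicAlgClIntegers 5) 2) (S : Set ℕ),
      ρ₀ ∈ modularLiftsOfTypeSigmaSemistable 5 2 (padicAlgClIntegers 5) ρ₀ S →
      (∀ (σ : absoluteGaloisGroup ℚ) (i : ℕ),
        Valued.v (((FramedRep.charpoly ρ₀ σ).coeff i : PadicAlgCl 5) -
          (FramedRep.charpoly (W.framedTateGaloisRep 5) σ).coeff i) < 1) →
      (∀ σ : absoluteGaloisGroup ℚ,
        (((ρ₀ σ : GL (Fin 2) (padicAlgClIntegers 5)) :
            Matrix (Fin 2) (Fin 2) (padicAlgClIntegers 5)).det : PadicAlgCl 5) =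
          ((W.framedTateGaloisRep 5 σ : GL (Fin 2) (PadicAlgCl 5)) :
            Matrix (Fin 2) (Fin 2) (PadicAlgCl 5)).det) →
      S.Finite → 5 ∉ S → (∀ q : ℕ, q.Prime → q ∣ W.conductorNorm ℤ → q ≠ 5 → q ∈ S) →
      ∃ ρ' ∈ modularLiftsOfTypeSigmaSemistable 5 2 (padicAlgClIntegers 5) ρ₀ S,
        ∃ S' : Set (HeightOneSpectrum (𝓞 ℚ)), S'.Finite ∧
          ∀ v ∉ S', ∀ 𝔓 ∈ v.primesAbove, ∀ σ : absoluteGaloisGroup ℚ, IsArithFrobAt (𝓞 ℚ) σ 𝔓 →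
            ((FramedRep.trace ρ' σ : padicAlgClIntegers 5) : PadicAlgCl 5) =
              FramedRep.trace (W.framedTateGaloisRep 5) σ

/-! ### The curve ↦ Galois adapters RC, UR, DET, ORD (one prover cycle each; UR, DET proved here,
ORD proved by k3-g10) -/

/-- **RC `ResidualCharpolysOfTorsionFive`** (1 cycle, S): a framing `ρ̄ ≅ W[5]` supplies the residual
characteristic polynomials of `ρ_{W,5}`: `det(X - ρ_{W,5}(σ)) ∈ ℤ̄₅[X]` reduces to
`det(X - (ρ̄ ⊗ 𝔽̄₅)(σ))`.  Proof plan: `P_σ := charpoly(σ | T₅W)` pushed along a ring map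
`f : ℤ₅ → ℤ̄₅` over `ℚ₅ → ℚ̄₅` (B1a `PadicIntHomCompat`); the first clause is gen 9's PROVED
`charpoly_framedTateGaloisRep_eq_map_map` (copied below), the second is the tree's PROVED
`IsTorsionGaloisRep.charpoly_eq_map_charpoly_galoisRepTate` (`charpoly ρ̄(σ) = charpoly(σ | T₅W) mod 5`)
plus `Matrix.charpoly_map` and B1a's residue compatibility.  (= the load-bearing half of gen 10's B1
file `STUB_IDEAS_stub_liftFive_2g10_B1.lean`, attached as item evidence 2026-08-31; its blocked import
`IrreducibleOfIrreducibleReduction` NOW BUILDS — this file imports it.) [cite: DarmonDiamondTaylor1995, §2.1 (p. 54)]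
[cite: SilvermanAEC2009, III.§7] -/
def ResidualCharpolysOfTorsionFive : Prop :=
  ∀ (W : WeierstrassCurve ℚ) [W.IsElliptic] (ρ : ModPGaloisRep ℚ (ZMod 5) 2),
    W.IsTorsionGaloisRep 5 ρ →
    HasResidualCharpolys (RingHom.id (padicAlgClResidueField 5))
      (W.framedTateGaloisRep 5 : absoluteGaloisGroup ℚ →* GL (Fin 2) (PadicAlgCl 5)) (residualModFive ρ)

/-- **B1a `PadicIntHomCompat`** (XS, verbatim from gen 10; reported PROVED in gen 10's B1 file): a ring
map `ℤ₅ → ℤ̄₅` over `ℚ₅ → ℚ̄₅` reducing to `x ↦ x mod 5`. [folklore] -/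
def PadicIntHomCompat : Prop :=
  ∃ f : ℤ_[5] →+* padicAlgClIntegers 5,
    (padicAlgClIntegers 5).subtype.comp f =
        (algebraMap ℚ_[5] (PadicAlgCl 5)).comp (PadicInt.Coe.ringHom (p := 5)) ∧
      ∀ x : ℤ_[5], residue (padicAlgClIntegers 5) (f x) =
        ((PadicInt.toZMod (p := 5) x).val : padicAlgClResidueField 5)

/-- **UR `UnramifiedOffConductorFive`** (PROVED below): `ρ_{W,5}` is unramified at every place `v` with
`p_v ∤ N_W` and `p_v ≠ 5` (Néron–Ogg–Shafarevich, easy direction, + `p ∣ N_W ↔` bad reduction).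
[cite: SilvermanAEC2009, Prop. VII.4.1(b)] [cite: DiamondShurman2005, §8.3 (p. 353)] -/
def UnramifiedOffConductorFive : Prop :=
  ∀ (W : WeierstrassCurve ℚ) [W.IsElliptic] (v : HeightOneSpectrum (𝓞 ℚ)),
    ¬ ((primesEquiv v : Nat.Primes) : ℕ) ∣ W.conductorNorm ℤ → ((primesEquiv v : Nat.Primes) : ℕ) ≠ 5 →
    (W.framedTateGaloisRep 5).IsUnramifiedAt v

/-- **ORD `OrdinaryAtFiveOfMultiplicative`** (= k3's `OrdinaryWeightTwoAtFiveShape`, gens 6/8/10, verbatim;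
**PROVED by k3-g10** `ordinaryWeightTwoAtFive` in `STUB_IDEAS_stub_liftFive_3g10.lean`, 0 sorries — cited,
not re-proved, since crux workfiles do not import one another): multiplicative reduction at `v ∣ 5` ⇒
`ρ_{W,5}` ordinary of weight `2` at `v` (Tate curve: `(χ₅ ∗; 0 1)` on inertia).
[cite: SilvermanATAEC1994, V §5 Thm. 5.3] [cite: SkinnerWiles1999, §1 Theorem (ii)] -/
def OrdinaryAtFiveOfMultiplicative : Prop :=
  ∀ (W : WeierstrassCurve ℚ) [W.IsElliptic] (v : HeightOneSpectrum (𝓞 ℚ)),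
    ((5 : ℕ) : 𝓞 ℚ) ∈ v.asIdeal → W.HasMultiplicativeReductionAt v →
    FramedGaloisRep.IsOrdinaryOfWeightAt 5 (W.framedTateGaloisRep 5) v 2 1

/-- **B1 `IrredFramedTateFive`** (gen 10, verbatim): `ρ̄` absolutely irreducible, `ρ̄ ≅ W[5]` ⇒
`ρ_{W,5}` irreducible.  PROVED below from RC (`irredFramedTateFive_of_rc`). [cite: DarmonDiamondTaylor1995, §2.1] -/
def IrredFramedTateFive : Prop :=
  ∀ (W : WeierstrassCurve ℚ) [W.IsElliptic] (ρ : ModPGaloisRep ℚ (ZMod 5) 2),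
    W.IsTorsionGaloisRep 5 ρ → FramedRep.IsAbsolutelyIrreducible ρ →
    FramedRep.IsIrreducible (W.framedTateGaloisRep 5)

/-! ### Proofs of the adapters -/

/-- `p_v ≠ 5 ⇒ 5 ∉ v` for a finite place `v` of `ℚ` (Mathlib `natGenerator_dvd_iff`). [folklore] -/
theorem five_not_mem_asIdeal_of_ne (v : HeightOneSpectrum (𝓞 ℚ))
    (hv : ((primesEquiv v : Nat.Primes) : ℕ) ≠ 5) : ((5 : ℕ) : 𝓞 ℚ) ∉ v.asIdeal := by
  intro h
  apply hv
  change natGenerator v = 5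
  rw [← Nat.prime_dvd_prime_iff_eq (prime_natGenerator v) Nat.prime_five, natGenerator_dvd_iff,
    ← map_natCast (Rat.IsIntegralClosure.intEquiv (𝓞 ℚ)) 5, Ideal.apply_mem_of_equiv_iff]
  exact h

/-- `5 ∈ v ⇒ p_v = 5`. [folklore] -/
theorem primesEquiv_eq_five_of_mem (v : HeightOneSpectrum (𝓞 ℚ))
    (hv : ((5 : ℕ) : 𝓞 ℚ) ∈ v.asIdeal) : ((primesEquiv v : Nat.Primes) : ℕ) = 5 := by
  by_contra h
  exact five_not_mem_asIdeal_of_ne v h hv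

/-- (PROVED) **UR**: `p_v ∤ N_W` ⇒ good reduction at `v` (`dvd_conductorNorm_iff`, PROVED in the tree by
Tate's algorithm) ⇒ unramified at `v ∤ 5` (`isUnramifiedAt_framedTateGaloisRep`). -/
theorem unramifiedOffConductorFive_holds : UnramifiedOffConductorFive := by
  intro W _ v hN hv
  have hgood : W.HasGoodReductionAt v := by
    by_contra h
    exact hN ((W.dvd_conductorNorm_iff v).mpr h)
  exact W.isUnramifiedAt_framedTateGaloisRep 5 hgood (five_not_mem_asIdeal_of_ne v hv)

/-- **H2a** (gen 9, PROVED, verbatim): the characteristic polynomial of the canonical frame is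
`charpoly(σ | T₅ E)` pushed along `ℤ₅ → ℚ₅ → ℚ̄₅`. [folklore] -/
theorem charpoly_framedTateGaloisRep_eq_map_map (W : WeierstrassCurve ℚ) [W.IsElliptic]
    (σ : absoluteGaloisGroup ℚ) :
    haveI := module_free_tateModule_holds W 5
    haveI := module_finite_tateModule_holds W 5
    FramedRep.charpoly (W.framedTateGaloisRep 5) σ =
      ((W.galoisRepTate 5 σ).charpoly.map (PadicInt.Coe.ringHom (p := 5))).map
        (algebraMap ℚ_[5] (PadicAlgCl 5)) := by
  haveI := module_free_tateModule_holds W 5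
  haveI := module_finite_tateModule_holds W 5
  rw [W.charpoly_framedTateGaloisRep_apply 5 σ]
  congr 1
  have hc : (algebraMap ℤ_[5] ℚ_[5] : ℤ_[5] →+* ℚ_[5]) = PadicInt.Coe.ringHom :=
    RingHom.ext fun _ => rfl
  rw [← hc]
  exact LinearMap.charpoly_baseChange (W.galoisRepTate 5 σ) ℚ_[5]

/-- **DET** (gen 9's H3a, PROVED, verbatim): `det ρ_{W,5}(σ) = χ₅(σ)` in `ℚ̄₅`
(`det_galoisRepTate_eq_cyclotomicCharacter_holds`, PROVED in the tree). [cite: SilvermanAEC2009, III.8.3] -/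
theorem det_framedTateGaloisRep_eq_cyclotomic (W : WeierstrassCurve ℚ) [W.IsElliptic]
    (σ : absoluteGaloisGroup ℚ) :
    ((W.framedTateGaloisRep 5 σ : GL (Fin 2) (PadicAlgCl 5)) : Matrix (Fin 2) (Fin 2) (PadicAlgCl 5)).det =
      algebraMap ℚ_[5] (PadicAlgCl 5) (PadicInt.Coe.ringHom (p := 5)
        ((GaloisRep.cyclotomicCharacter ℚ 5 σ : ℤ_[5]ˣ) : ℤ_[5])) := by
  have h5 : ((5 : ℕ) : ℚ) ≠ 0 := by norm_num
  haveI := module_free_tateModule_holds W 5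
  haveI := module_finite_tateModule_holds W 5
  rw [Matrix.det_eq_sign_charpoly_coeff]
  have hc : ((W.framedTateGaloisRep 5 σ : GL (Fin 2) (PadicAlgCl 5)) :
      Matrix (Fin 2) (Fin 2) (PadicAlgCl 5)).charpoly = FramedRep.charpoly (W.framedTateGaloisRep 5) σ := rfl
  rw [hc, charpoly_framedTateGaloisRep_eq_map_map W σ, Polynomial.coeff_map, Polynomial.coeff_map,
    Fintype.card_fin]
  have hdet := LinearMap.det_eq_sign_charpoly_coeff (W.galoisRepTate 5 σ)
  rw [finrank_tateModule_eq_two_holds W 5 h5] at hdet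
  rw [← W.det_galoisRepTate_eq_cyclotomicCharacter_holds 5 h5 σ, hdet]
  norm_num

/-- **The ring map `ℤ₅ → ℤ̄₅`** over `ℚ₅ → ℚ̄₅` (`‖x‖ ≤ 1` is preserved: `PadicAlgCl.norm_extends`),
the witness of B1a. [folklore] -/
def padicIntToAlgClIntegers : ℤ_[5] →+* padicAlgClIntegers 5 :=
  ((algebraMap ℚ_[5] (PadicAlgCl 5)).comp (PadicInt.Coe.ringHom (p := 5))).codRestrict
    (padicAlgClIntegers 5) fun x => by
      rw [padicAlgCl_mem_valuationSubring_iff]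
      change ‖((x : ℚ_[5]) : PadicAlgCl 5)‖ ≤ 1
      rw [PadicAlgCl.norm_extends, ← PadicInt.norm_def]
      exact PadicInt.norm_le_one x

/-- Unfolding lemma for `padicIntToAlgClIntegers`. [folklore] -/
@[simp] theorem coe_padicIntToAlgClIntegers (x : ℤ_[5]) :
    ((padicIntToAlgClIntegers x : padicAlgClIntegers 5) : PadicAlgCl 5) =
      algebraMap ℚ_[5] (PadicAlgCl 5) (x : ℚ_[5]) := rfl

/-- (PROVED) **B1a `PadicIntHomCompat`**: `x - (x mod 5) ∈ 5ℤ₅` (`PadicInt.toZMod_spec`) has norm `< 1`,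
hence so does its image in `ℤ̄₅`, i.e. the residues agree (`residue_eq_of_norm_sub_lt_one`). -/
theorem padicIntHomCompat_holds : PadicIntHomCompat := by
  refine ⟨padicIntToAlgClIntegers, RingHom.ext fun x => rfl, fun x => ?_⟩
  rw [← map_natCast (residue (padicAlgClIntegers 5)) (PadicInt.toZMod (p := 5) x).val]
  apply residue_eq_of_norm_sub_lt_one
  have hmem := PadicInt.toZMod_spec x
  rw [IsLocalRing.mem_maximalIdeal, PadicInt.mem_nonunits, ZMod.cast_eq_val] at hmem
  rw [← map_natCast padicIntToAlgClIntegers (PadicInt.toZMod (p := 5) x).val,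
    ← AddSubgroupClass.coe_sub, ← map_sub, coe_padicIntToAlgClIntegers]
  change ‖(((x - ((PadicInt.toZMod (p := 5) x).val : ℤ_[5]) : ℤ_[5]) : ℚ_[5]) : PadicAlgCl 5)‖ < 1
  rw [PadicAlgCl.norm_extends, ← PadicInt.norm_def]
  exact hmem

/-- (PROVED) **RC from B1a**: `P_σ := charpoly(σ | T₅ W) ∈ ℤ₅[X]` pushed to `ℤ̄₅[X]`; it maps to
`charpoly ρ_{W,5}(σ)` in `ℚ̄₅[X]` (H2a) and reduces to `charpoly ρ̄(σ) ⊗ 𝔽̄₅`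
(`IsTorsionGaloisRep.charpoly_eq_map_charpoly_galoisRepTate`, PROVED in the tree). -/
theorem residualCharpolysOfTorsionFive_of_compat (hB1a : PadicIntHomCompat) :
    ResidualCharpolysOfTorsionFive := by
  obtain ⟨f, hf, hres⟩ := hB1a
  intro W _ ρ hρ σ
  haveI := module_free_tateModule_holds W 5
  haveI := module_finite_tateModule_holds W 5
  have h5 : ((5 : ℕ) : ℚ) ≠ 0 := by norm_num
  refine ⟨((W.galoisRepTate 5 σ).charpoly).map f, ?_, ?_⟩
  · rw [Polynomial.map_map, hf, ← Polynomial.map_map]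
    exact (charpoly_framedTateGaloisRep_eq_map_map W σ).symm
  · have hR : ((residualModFive ρ σ : GL (Fin 2) (padicAlgClResidueField 5)) :
        Matrix (Fin 2) (Fin 2) (padicAlgClResidueField 5)).charpoly =
        (((ρ σ : GL (Fin 2) (ZMod 5)) : Matrix (Fin 2) (Fin 2) (ZMod 5)).charpoly).map
          (zmodToPadicAlgClResidueField 5) := by
      rw [← Matrix.charpoly_map]
      rfl
    rw [Polynomial.map_map, hR, hρ.charpoly_eq_map_charpoly_galoisRepTate W 5 h5 σ, Polynomial.map_map]
    congr 1
    refine RingHom.ext fun x => ?_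
    rw [RingHom.comp_apply, RingHom.comp_apply, RingHom.id_apply, hres x, RingHom.comp_apply]
    conv_rhs => rw [← ZMod.natCast_zmod_val (PadicInt.toZMod (p := 5) x)]
    rw [map_natCast]

/-- (PROVED) **RC `ResidualCharpolysOfTorsionFive`.** -/
theorem residualCharpolysOfTorsionFive_holds : ResidualCharpolysOfTorsionFive :=
  residualCharpolysOfTorsionFive_of_compat padicIntHomCompat_holds

/-- (PROVED) **B1 ⟸ RC**: `ρ̄ ⊗ 𝔽̄₅` is irreducible (absolute irreducibility of `ρ̄`, read through
`𝔽₅ → ℤ̄₅/𝔪`; `glRepresentation (residualModFive ρ̄)` is `ρ̄.baseChangeRepresentation _` by `rfl`), and a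
`5`-adic representation with irreducible residual characteristic polynomials is irreducible
(`FramedGaloisRep.isIrreducible_of_hasResidualCharpolys`, DDT §2.1, PROVED in the tree). -/
theorem irredFramedTateFive_of_rc (hRC : ResidualCharpolysOfTorsionFive) : IrredFramedTateFive := by
  intro W _ ρ hρ habs
  have hirr : (glRepresentation (residualModFive ρ)).IsIrreducible :=
    habs (padicAlgClResidueField 5) (zmodToPadicAlgClResidueField 5)
  exact FramedGaloisRep.isIrreducible_of_hasResidualCharpolys (W.framedTateGaloisRep 5) (hRC W ρ hρ) hirr

/-- (PROVED) **THE GEN-11 ADAPTER: X⁵ + RC ⇒ X‴ₒ.**  Instantiate the W-free debt at `τ := ρ_{W,5}`: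
(a) is RC, (b) is DET, (c) is UR (a place `v` with `p_v ∉ S`, `p_v ≠ 5` has `p_v ∤ N_W` by the
`S`-hypothesis of X‴), (d) is the extra hypothesis of X‴ₒ, (e) is carried over verbatim. -/
theorem mltFrobTraceFiveOrd_of_galois (hX : DiamondCor62FrobTraceFiveOrd)
    (hRC : ResidualCharpolysOfTorsionFive) : MLTFrobTraceFiveOrd := by
  intro W _ ρ hρ habs _h25 hord ρ₀ S hmem hcong hdet hSfin h5S hS
  have hunr : ∀ v : HeightOneSpectrum (𝓞 ℚ), ((primesEquiv v : Nat.Primes) : ℕ) ∉ S →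
      ((primesEquiv v : Nat.Primes) : ℕ) ≠ 5 → (W.framedTateGaloisRep 5).IsUnramifiedAt v := by
    intro v hvS hv5
    refine unramifiedOffConductorFive_holds W v (fun hdvd => hvS ?_) hv5
    exact hS _ (primesEquiv v).2 hdvd hv5
  exact hX ρ (W.framedTateGaloisRep 5) habs (hRC W ρ hρ) (det_framedTateGaloisRep_eq_cyclotomic W)
    ρ₀ S hmem hcong hdet hSfin h5S hunr hord

/-- (PROVED) **ORD + X‴ₒ ⇒ X‴ₘ** (the consumer's regime). -/
theorem mltFrobTraceFiveMult_of_ord (hO : OrdinaryAtFiveOfMultiplicative) (hX : MLTFrobTraceFiveOrd) :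
    MLTFrobTraceFiveMult := by
  intro W _ ρ hρ habs h25 hmult ρ₀ S hmem hcong hdet hSfin h5S hS
  exact hX W ρ hρ habs h25 (fun v hv => hO W v hv (hmult v hv)) ρ₀ S hmem hcong hdet hSfin h5S hS

/-- (PROVED) the whole gen-11 entry: **X⁵ + RC + ORD ⇒ X‴ₘ**. -/
theorem mltFrobTraceFiveMult_of_galois (hX : DiamondCor62FrobTraceFiveOrd)
    (hRC : ResidualCharpolysOfTorsionFive) (hO : OrdinaryAtFiveOfMultiplicative) :
    MLTFrobTraceFiveMult :=
  mltFrobTraceFiveMult_of_ord hO (mltFrobTraceFiveOrd_of_galois hX hRC)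

/-! ### Sanity: the regime forms are WEAKENINGS of gen 10's X‴ -/

/-- (PROVED) X‴ ⇒ X‴ₒ (drop the ordinarity hypothesis). -/
theorem frobTraceFiveOrd_of_frobTrace (h : MLTFrobTraceFive) : MLTFrobTraceFiveOrd :=
  fun W _ ρ hρ habs h25 _ ρ₀ S hmem hcong hdet hSfin h5S hS =>
    h W ρ hρ habs h25 ρ₀ S hmem hcong hdet hSfin h5S hS

/-- (PROVED) X‴ ⇒ X‴ₘ (drop the multiplicativity hypothesis). -/
theorem frobTraceFiveMult_of_frobTrace (h : MLTFrobTraceFive) : MLTFrobTraceFiveMult :=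
  fun W _ ρ hρ habs h25 _ ρ₀ S hmem hcong hdet hSfin h5S hS =>
    h W ρ hρ habs h25 ρ₀ S hmem hcong hdet hSfin h5S hS

/-! ### Gen 10's chain threaded through the multiplicative regime: X‴ₘ ⇒ X″ₘ ⇒ X′ₘ (proofs = gen 10's) -/

/-- **X″ₘ**: gen 10's X″ `MLTTraceFive` (all-`σ` traces) restricted to curves multiplicative over `5`. -/
def MLTTraceFiveMult : Prop :=
  ∀ (W : WeierstrassCurve ℚ) [W.IsElliptic] (ρ : ModPGaloisRep ℚ (ZMod 5) 2),
    W.IsTorsionGaloisRep 5 ρ → ρ.IsAbsIrreducibleOverSqrt 5 → ¬ 25 ∣ W.conductorNorm ℤ →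
    (∀ v : HeightOneSpectrum (𝓞 ℚ), ((5 : ℕ) : 𝓞 ℚ) ∈ v.asIdeal → W.HasMultiplicativeReductionAt v) →
    ∀ (ρ₀ : FramedGaloisRep ℚ (padicAlgClIntegers 5) 2) (S : Set ℕ),
      ρ₀ ∈ modularLiftsOfTypeSigmaSemistable 5 2 (padicAlgClIntegers 5) ρ₀ S →
      (∀ (σ : absoluteGaloisGroup ℚ) (i : ℕ),
        Valued.v (((FramedRep.charpoly ρ₀ σ).coeff i : PadicAlgCl 5) -
          (FramedRep.charpoly (W.framedTateGaloisRep 5) σ).coeff i) < 1) →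
      (∀ σ : absoluteGaloisGroup ℚ,
        (((ρ₀ σ : GL (Fin 2) (padicAlgClIntegers 5)) :
            Matrix (Fin 2) (Fin 2) (padicAlgClIntegers 5)).det : PadicAlgCl 5) =
          ((W.framedTateGaloisRep 5 σ : GL (Fin 2) (PadicAlgCl 5)) :
            Matrix (Fin 2) (Fin 2) (PadicAlgCl 5)).det) →
      S.Finite → 5 ∉ S → (∀ q : ℕ, q.Prime → q ∣ W.conductorNorm ℤ → q ≠ 5 → q ∈ S) →
      ∃ ρ' ∈ modularLiftsOfTypeSigmaSemistable 5 2 (padicAlgClIntegers 5) ρ₀ S,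
        ∀ σ : absoluteGaloisGroup ℚ,
          ((FramedRep.trace ρ' σ : padicAlgClIntegers 5) : PadicAlgCl 5) =
            FramedRep.trace (W.framedTateGaloisRep 5) σ

/-- **X′ₘ**: gen 8's X′ `MLTTateSemistableFive'` (conjugacy) restricted to curves multiplicative over `5`
— what the gen-8 consumer `liftFiveFromCurve_of_pieces` uses at the Frey curve in case B (which IS
multiplicative at `5`: k3-g4 G1). -/
def MLTTateSemistableFiveMult : Prop :=
  ∀ (W : WeierstrassCurve ℚ) [W.IsElliptic] (ρ : ModPGaloisRep ℚ (ZMod 5) 2),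
    W.IsTorsionGaloisRep 5 ρ → ρ.IsAbsIrreducibleOverSqrt 5 → ¬ 25 ∣ W.conductorNorm ℤ →
    (∀ v : HeightOneSpectrum (𝓞 ℚ), ((5 : ℕ) : 𝓞 ℚ) ∈ v.asIdeal → W.HasMultiplicativeReductionAt v) →
    ∀ (hf : Continuous (padicAlgClIntegers 5).subtype)
      (ρ₀ : FramedGaloisRep ℚ (padicAlgClIntegers 5) 2) (S : Set ℕ),
      ρ₀ ∈ modularLiftsOfTypeSigmaSemistable 5 2 (padicAlgClIntegers 5) ρ₀ S →
      (∀ (σ : absoluteGaloisGroup ℚ) (i : ℕ),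
        Valued.v (((FramedRep.charpoly ρ₀ σ).coeff i : PadicAlgCl 5) -
          (FramedRep.charpoly (W.framedTateGaloisRep 5) σ).coeff i) < 1) →
      (∀ σ : absoluteGaloisGroup ℚ,
        (((ρ₀ σ : GL (Fin 2) (padicAlgClIntegers 5)) :
            Matrix (Fin 2) (Fin 2) (padicAlgClIntegers 5)).det : PadicAlgCl 5) =
          ((W.framedTateGaloisRep 5 σ : GL (Fin 2) (PadicAlgCl 5)) :
            Matrix (Fin 2) (Fin 2) (PadicAlgCl 5)).det) →
      S.Finite → 5 ∉ S → (∀ q : ℕ, q.Prime → q ∣ W.conductorNorm ℤ → q ≠ 5 → q ∈ S) →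
      ∃ ρ' ∈ modularLiftsOfTypeSigmaSemistable 5 2 (padicAlgClIntegers 5) ρ₀ S,
        ∃ P : GL (Fin 2) (PadicAlgCl 5),
          FramedRep.conj P (FramedRep.baseChange (padicAlgClIntegers 5).subtype hf ρ') =
            W.framedTateGaloisRep 5

/-- (PROVED) **X‴ₘ ⇒ X″ₘ**: Frobenii off a finite set are dense (`frobenius_dense` fed with the tree's
CLOSED `chebotarev_artinRep_holds`), traces are continuous, `ℚ̄₅` is Hausdorff (gen 10's proof). -/
theorem mltTraceFiveMult_of_frobTraceMult (h : MLTFrobTraceFiveMult) : MLTTraceFiveMult := by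
  intro W _ ρ hρ habs h25 hmult ρ₀ S hmem hcong hdet hSfin h5S hS
  obtain ⟨ρ', hρ', S', hS'fin, hfrob⟩ := h W ρ hρ habs h25 hmult ρ₀ S hmem hcong hdet hSfin h5S hS
  refine ⟨ρ', hρ', ?_⟩
  have hf : Continuous (padicAlgClIntegers 5).subtype := continuous_subtype_val
  have hdense := absoluteGaloisGroup.frobenius_dense chebotarev_artinRep_holds ℚ S' hS'fin
  have hc1 : Continuous fun σ : absoluteGaloisGroup ℚ =>
      ((FramedRep.trace ρ' σ : padicAlgClIntegers 5) : PadicAlgCl 5) := by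
    have : (fun σ : absoluteGaloisGroup ℚ =>
        ((FramedRep.trace ρ' σ : padicAlgClIntegers 5) : PadicAlgCl 5)) =
        FramedRep.trace (FramedRep.baseChange (padicAlgClIntegers 5).subtype hf ρ') := by
      funext σ
      change (padicAlgClIntegers 5).subtype (FramedRep.trace ρ' σ) = _
      unfold FramedRep.trace
      rw [AddMonoidHom.map_trace, FramedRep.coe_baseChange_apply]
    rw [this]
    exact FramedRep.continuous_trace _
  have hc2 : Continuous (FramedRep.trace (W.framedTateGaloisRep 5)) := FramedRep.continuous_trace _
  have heq := Continuous.ext_on hdense hc1 hc2 fun σ ⟨v, hv, 𝔓, h𝔓, hσ⟩ => hfrob v hv 𝔓 h𝔓 σ hσ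
  exact fun σ => congrFun heq σ

/-- (PROVED) **X″ₘ ⇒ X′ₘ** given B1: equal traces and determinants ⇒ equal characteristic polynomials
(rank `2`) ⇒ `ρ' ⊗ ℚ̄₅` irreducible like `ρ_{W,5}` ⇒ both semisimple ⇒ conjugate (Brauer–Nesbitt in
characteristic `0`, `SorensenPatching.exists_conj_of_trace_eq`) (gen 10's proof). -/
theorem mltTateSemistableFiveMult_of_traceMult (hB : IrredFramedTateFive) (hX : MLTTraceFiveMult) :
    MLTTateSemistableFiveMult := by
  intro W _ ρ hρ habs h25 hmult hf ρ₀ S hmem hcong hdet hSfin h5S hS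
  obtain ⟨ρ', hρ', htr⟩ := hX W ρ hρ habs h25 hmult ρ₀ S hmem hcong hdet hSfin h5S hS
  refine ⟨ρ', hρ', ?_⟩
  obtain ⟨-, -, hdet', -⟩ := hρ'
  set τ : FramedGaloisRep ℚ (PadicAlgCl 5) 2 :=
    FramedRep.baseChange (padicAlgClIntegers 5).subtype hf ρ' with hτ
  have htr' : ∀ σ, FramedRep.trace τ σ = FramedRep.trace (W.framedTateGaloisRep 5) σ := fun σ => by
    rw [← htr σ]
    change _ = (padicAlgClIntegers 5).subtype (FramedRep.trace ρ' σ)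
    unfold FramedRep.trace
    rw [AddMonoidHom.map_trace, hτ, FramedRep.coe_baseChange_apply]
  have hdet'' : ∀ σ, ((τ σ : GL (Fin 2) (PadicAlgCl 5)) : Matrix (Fin 2) (Fin 2) (PadicAlgCl 5)).det =
      ((W.framedTateGaloisRep 5 σ : GL (Fin 2) (PadicAlgCl 5)) :
        Matrix (Fin 2) (Fin 2) (PadicAlgCl 5)).det := fun σ => by
    have h3 := hdet' σ
    rw [Algebra.algebraMap_self_apply] at h3
    rw [← hdet σ, ← h3, hτ, FramedRep.coe_baseChange_apply, ← RingHom.mapMatrix_apply,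
      ← RingHom.map_det]
    rfl
  have hcp : ∀ σ, ((τ σ : GL (Fin 2) (PadicAlgCl 5)) : Matrix (Fin 2) (Fin 2) (PadicAlgCl 5)).charpoly =
      ((W.framedTateGaloisRep 5 σ : GL (Fin 2) (PadicAlgCl 5)) :
        Matrix (Fin 2) (Fin 2) (PadicAlgCl 5)).charpoly := fun σ => by
    rw [Matrix.charpoly_fin_two, Matrix.charpoly_fin_two, hdet'' σ]
    change X ^ 2 - C (FramedRep.trace τ σ) * X + _ = X ^ 2 - C (FramedRep.trace _ σ) * X + _
    rw [htr' σ]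
  have hirrW : FramedRep.IsIrreducible (W.framedTateGaloisRep 5) :=
    hB W ρ hρ habs.isAbsolutelyIrreducible
  have hirrτ : FramedRep.IsIrreducible τ :=
    Literature.RepresentationTheory.Semisimple.isIrreducible_of_charpoly_eq
      (τ : absoluteGaloisGroup ℚ →* GL (Fin 2) (PadicAlgCl 5))
      (W.framedTateGaloisRep 5 : absoluteGaloisGroup ℚ →* GL (Fin 2) (PadicAlgCl 5)) hcp hirrW
  have hssτ : τ.toRepresentation.IsSemisimpleRepresentation :=
    isSemisimpleRepresentation_of_isIrreducible hirrτ
  have hssW : (W.framedTateGaloisRep 5).toRepresentation.IsSemisimpleRepresentation :=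
    isSemisimpleRepresentation_of_isIrreducible hirrW
  obtain ⟨P, hP⟩ := SorensenPatching.exists_conj_of_trace_eq τ (W.framedTateGaloisRep 5) hssτ hssW htr'
  exact ⟨P, ContinuousMonoidHom.ext fun σ => by rw [FramedRep.conj_apply]; exact (hP σ).symm⟩

/-- (PROVED) **The gen-11 debt chain, end to end: X⁵ + RC + ORD ⇒ X′ₘ** (conjugacy of `ρ_{W,5}` to a
member of `Φ_S`, for every `W` semistable-multiplicative at `5` with absolutely irreducible `W[5]|ℚ(√5)`):
RC gives B1; X⁵+RC+ORD give X‴ₘ; then X‴ₘ ⇒ X″ₘ ⇒ X′ₘ. -/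
theorem debtMult_of_galois (hX : DiamondCor62FrobTraceFiveOrd) (hRC : ResidualCharpolysOfTorsionFive)
    (hO : OrdinaryAtFiveOfMultiplicative) : MLTTateSemistableFiveMult :=
  mltTateSemistableFiveMult_of_traceMult (irredFramedTateFive_of_rc hRC)
    (mltTraceFiveMult_of_frobTraceMult (mltFrobTraceFiveMult_of_galois hX hRC hO))

/-- (PROVED) **B1 `IrredFramedTateFive` outright** (gen 10's B1, now kernel-checked IN THE TREE). -/
theorem irredFramedTateFive_holds : IrredFramedTateFive :=
  irredFramedTateFive_of_rc residualCharpolysOfTorsionFive_holds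

/-- (PROVED) **Net gen-11 statement of the k2 line's lifting step**: the W-free debt X⁵ and the local
corner ORD (k3-g10, proved) give X′ₘ — conjugacy of `ρ_{W,5}` to a member of `Φ_S` for every curve
multiplicative at `5` whose `W[5]|ℚ(√5)` is absolutely irreducible; everything else on the curve side
(RC, B1a, B1, UR, DET, Chebotarev, Brauer–Nesbitt) is proved in this file or the tree. -/
theorem debtMult_of_X5_ORD (hX : DiamondCor62FrobTraceFiveOrd) (hO : OrdinaryAtFiveOfMultiplicative) :
    MLTTateSemistableFiveMult :=
  debtMult_of_galois hX residualCharpolysOfTorsionFive_holds hO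

/-- (PROVED) sanity: gen 8's X′ ⇒ X′ₘ (so the consumer-side re-glue only ever WEAKENS what it asks). -/
theorem debtMult_of_debt (h : MLTTateSemistableFive') : MLTTateSemistableFiveMult :=
  fun W _ ρ hρ habs h25 _ hf ρ₀ S hmem hcong hdet hSfin h5S hS =>
    h W ρ hρ habs h25 hf ρ₀ S hmem hcong hdet hSfin h5S hS

end Summit.ABC.ABC.Cruxes.FreyModularity.StubIdeas.LiftFive2g11

end
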